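import Summits.PneNP.PneNP.Theorems.ConvexRankGatesLinAlgGateBlindPlanting
import Summits.PneNP.PneNP.Theorems.ConvexRankGatesLinAlgGateBlindDenseRegime
import Summits.PneNP.PneNP.Theorems.ConvexRankGatesLinAlgGateBlindPermSmallDimAux

/-!
# Route ConvexRankGates, crux `LinAlgGateBlind` (stmt-PneNP-10681): SG for COMMUTATIVE PERM gates up to `d ≤ m^{3/4-o(1)}`

Support lemma for the research stub `stub_sgPerm` (line `dnf-invariant-wide-gates-see-small-cliques`), in the exact
vocabulary of the line (`SGAt`, `lOf`, `kOf`, `qOf`, `epsOf`, `Theorems/ConvexRankGatesLinAlgGateBlindDefs.lean`).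

The landed generic range of `stub_sgPerm` is `d ≤ m^{3/8-o(1)}` (`sgAt_perm_of_dim_le`): the planting theorem
`sg_of_maxtermCover` needs a maxterm cover by `N ≤ 2^{m^{3/4}/2}` all-off events, and a general `PERM_d` gate is
covered by its target-avoiding subgroups, `N ≤ #Sub(Sym d) = 2^{O(d² log² d)}`. For the sub-class of PERM gates whose
GENERATORS PAIRWISE COMMUTE (the abelian PERM door, which contains every monotone span program over `𝔽_p`,
`Cruxes/LinAlgGateBlind/Disproof.lean: spanProgram_isPermGate`) the cover is exponentially smaller: the generated
group `G₀ = ⟨σ_i⟩ ≤ Sym(d')` is a finite abelian group, a rejected graph's present generators span a subgroup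
`W ∌ τ`, and by duality of finite abelian groups (Mathlib `CommGroup.exists_apply_ne_one_of_hasEnoughRootsOfUnity`)
some character `φ : G₀ → ℂˣ` is trivial on `W` but not at `τ`; conversely "all generators with `φ(σ_i) ≠ 1` absent"
forces rejection. So the rejection region is covered by the all-off events of the characters non-trivial at `τ`,
`N ≤ |Ĝ₀| = |G₀| ≤ d'! ≤ d!` (`CommGroup.card_monoidHom_of_hasEnoughRootsOfUnity`), i.e. `log₂ N ≤ d log₂ d`.

* `sgAt_commPerm_of_cover_budget` — finite form with the fragility budget `d! · (1/2)^{ν+1} · #𝒱(l) < ε`;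
* `sgAt_commPerm_of_fewPoints` (registered) — for every `c`, eventually in `m`, for every `d` with
  `log₂ (d!) ≤ m^{3/4}/2`: `SGAt m (commutative PERM_d gates) (lOf m) (kOf m) (qOf m) (epsOf c m)`;
* `commPermGate_isPermGate` — the class is a sub-class of `IsPermGate d`.

The class is written inline (no new definitions): gates `g` with `d' ≤ d`, generators `σ : Fin g.1 → Sym(d')`
pairwise commuting, a target `τ`, and `g.2 v ↔ τ ∈ ⟨σ_i : v_i⟩`. [folklore]
-/

-- `Summit.PneNP.PneNP.…` duplicates `PneNP` BY DESIGN (single-problem summit).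
set_option linter.dupNamespace false

namespace Summit.PneNP.PneNP.Theorems

open Finset Filter Literature.Computability.Complexity Razborov
open Summit.PneNP.PneNP.Cruxes.LinAlgGateBlind.DnfInvariantWideGatesSeeSmallCliques

/-- Commutative PERM gates are PERM gates. [folklore] -/
theorem commPermGate_isPermGate (d : ℕ) (g : GateFn)
    (hg : ∃ d', d' ≤ d ∧ ∃ (σ : Fin g.1 → Equiv.Perm (Fin d')) (τ : Equiv.Perm (Fin d')),
      (∀ i j, σ i * σ j = σ j * σ i) ∧ ∀ v, g.2 v = true ↔ τ ∈ Subgroup.closure (σ '' {i | v i = true})) :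
    IsPermGate d g := by
  obtain ⟨d', hd', σ, τ, -, h⟩ := hg
  exact ⟨d', hd', σ, τ, h⟩

open scoped IsMulCommutative in
/-- **SG for commutative PERM gates with a fragility budget (finite form).** With `1 - q^{C(l,2)} ≤ 1/2`,
`2t ≤ l`, the positive budget `(ν·C(l,2))^t·C(m-t,k-t) ≤ ε·C(m,k)` and the fragility budget
`d! · (1/2)^{ν+1} · #𝒱(l) < ε`: `SGAt m (commutative PERM_d gates) l k q ε`. [folklore] -/
theorem sgAt_commPerm_of_cover_budget :
    ∀ (m l k d ν t : ℕ) (q ε : ℝ), 0 ≤ q → q ≤ 1 → 1 - q ^ (l.choose 2) ≤ 1 / 2 → 0 < ε → 2 * t ≤ l →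
      (((ν * l.choose 2) ^ t * (m - t).choose (k - t) : ℕ) : ℝ) ≤ ε * (m.choose k : ℝ) →
      ((d.factorial : ℕ) : ℝ) * (1 / 2) ^ (ν + 1) * #(smallSets (Fin m) l) < ε →
      SGAt m (fun g => ∃ d', d' ≤ d ∧ ∃ (σ : Fin g.1 → Equiv.Perm (Fin d')) (τ : Equiv.Perm (Fin d')),
          (∀ i j, σ i * σ j = σ j * σ i) ∧ ∀ v, g.2 v = true ↔ τ ∈ Subgroup.closure (σ '' {i | v i = true}))
        l k q ε := by
  intro m l k d ν t q ε hq0 hq1 hql hε htl hpos hfrag O hO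
  classical
  obtain ⟨g, ⟨d', hd', σ, τ, hcomm, hg⟩, X, hX, hOX⟩ := hO
  have hV : (0 : ℝ) < #(smallSets (Fin m) l) := Nat.cast_pos.2 (card_pos.2 ⟨∅, empty_mem_smallSets l⟩)
  -- `O` in terms of the permutation data
  have hOiff : ∀ x, O x = true ↔ τ ∈ Subgroup.closure (σ '' {i | CliquePresent (X i) x}) := by
    intro x
    rw [hOX x, hg]
    have hset : {i | (fun a => atomB (X a) x) i = true} = {i | CliquePresent (X i) x} := by
      ext i
      simp [atomB]
    rw [hset]
  -- the ambient finite abelian group generated by the generators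
  set G₀ : Subgroup (Equiv.Perm (Fin d')) := Subgroup.closure (Set.range σ) with hG₀
  haveI : IsMulCommutative G₀ := Subgroup.isMulCommutative_closure (by
    rintro _ ⟨i, rfl⟩ _ ⟨j, rfl⟩
    exact hcomm i j)
  by_cases hτ : τ ∈ G₀
  swap
  · -- `τ` is never generated: `O ≡ 0`, the empty DNF is exact
    have hO0 : ∀ x, O x = false := by
      intro x
      cases hx : O x
      · rfl
      · exfalso
        refine hτ ((Subgroup.closure_mono ?_) ((hOiff x).1 hx))
        rintro _ ⟨i, -, rfl⟩
        exact ⟨i, rfl⟩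
    refine ⟨∅, empty_subset _, ?_, ?_⟩
    · have : lostPos m k O ∅ = ∅ := filter_eq_empty_iff.2 fun S _ h => by
        rw [hO0] at h
        exact Bool.false_ne_true h.1
      rw [this, card_empty, Nat.cast_zero]
      positivity
    · have : gainedNeg m q O ∅ = 0 := by
        unfold gainedNeg
        rw [prob_congr (Q := fun _ => False) fun x => ⟨fun h => ?_, fun h => h.elim⟩, prob_false]
        obtain ⟨W, hW, -⟩ := h.2
        exact notMem_empty W hW
      rw [this]
      exact hε.le
  -- elements of `G₀`
  set τ₀ : G₀ := ⟨τ, hτ⟩ with hτ₀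
  set σ₀ : Fin g.1 → G₀ := fun i => ⟨σ i, Subgroup.subset_closure ⟨i, rfl⟩⟩ with hσ₀
  set W₀ : (KEdge m → Bool) → Subgroup G₀ := fun x =>
    Subgroup.closure (σ₀ '' {i | CliquePresent (X i) x}) with hW₀
  have hWmap : ∀ x, Subgroup.closure (σ '' {i | CliquePresent (X i) x}) = (W₀ x).map G₀.subtype := by
    intro x
    rw [hW₀, MonoidHom.map_closure, Set.image_image]
    rfl
  have hOiff' : ∀ x, O x = true ↔ τ₀ ∈ W₀ x := by
    intro x
    rw [hOiff x, hWmap x, Subgroup.mem_map]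
    constructor
    · rintro ⟨y, hy, hyτ⟩
      have : y = τ₀ := Subtype.ext hyτ
      rwa [this] at hy
    · intro h
      exact ⟨τ₀, h, rfl⟩
  -- the maxterm cover by characters
  haveI hne0 : NeZero ((Monoid.exponent G₀ : ℕ) : ℂ) := ⟨by exact_mod_cast Monoid.exponent_ne_zero_of_finite⟩
  have hiff : ∀ x, O x = false ↔
      ∃ φ : G₀ →* ℂˣ, φ τ₀ ≠ 1 ∧ ∀ i, φ (σ₀ i) ≠ 1 → ¬ CliquePresent (X i) x := by
    intro x
    constructor
    · intro hx
      have hτW : τ₀ ∉ W₀ x := fun h => by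
        have := (hOiff' x).2 h
        rw [hx] at this
        exact Bool.false_ne_true this
      haveI : NeZero ((Monoid.exponent (G₀ ⧸ W₀ x) : ℕ) : ℂ) :=
        ⟨by exact_mod_cast Monoid.exponent_ne_zero_of_finite⟩
      have hne : (QuotientGroup.mk' (W₀ x)) τ₀ ≠ 1 := by
        rwa [Ne, QuotientGroup.mk'_apply, QuotientGroup.eq_one_iff]
      obtain ⟨φ, hφ⟩ := CommGroup.exists_apply_ne_one_of_hasEnoughRootsOfUnity (G₀ ⧸ W₀ x) ℂ hne
      refine ⟨φ.comp (QuotientGroup.mk' (W₀ x)), hφ, fun i hi hpres => hi ?_⟩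
      rw [MonoidHom.comp_apply]
      have : (QuotientGroup.mk' (W₀ x)) (σ₀ i) = 1 := by
        rw [QuotientGroup.mk'_apply, QuotientGroup.eq_one_iff]
        exact Subgroup.subset_closure ⟨i, hpres, rfl⟩
      rw [this, map_one]
    · rintro ⟨φ, hφτ, hφσ⟩
      cases hx : O x
      · rfl
      · exfalso
        have hle : W₀ x ≤ φ.ker := by
          refine (Subgroup.closure_le _).2 ?_
          rintro _ ⟨i, hi, rfl⟩
          by_contra hk
          exact hφσ i hk hi
        exact hφτ (hle ((hOiff' x).1 hx))
  -- counting the characters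
  have hcardHom : Nat.card (G₀ →* ℂˣ) = Nat.card G₀ := CommGroup.card_monoidHom_of_hasEnoughRootsOfUnity G₀ ℂ
  haveI : Finite (G₀ →* ℂˣ) := by
    refine Nat.finite_of_card_ne_zero ?_
    rw [hcardHom]
    exact Nat.card_pos.ne'
  set J := {φ : G₀ →* ℂˣ // φ τ₀ ≠ 1} with hJ
  set N := Nat.card J with hNdef
  set e : J ≃ Fin N := Finite.equivFin J with he
  set 𝓛 : Fin N → Finset (Finset (Fin m)) :=
    fun j => (univ.filter fun i => (e.symm j).1 (σ₀ i) ≠ 1).image X with h𝓛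
  have hNle : (N : ℝ) ≤ ((d.factorial : ℕ) : ℝ) := by
    have h1 : N ≤ Nat.card (G₀ →* ℂˣ) :=
      Nat.card_le_card_of_injective (Subtype.val : J → (G₀ →* ℂˣ)) Subtype.val_injective
    have h2 : Nat.card G₀ ≤ Nat.card (Equiv.Perm (Fin d')) :=
      Nat.card_le_card_of_injective (Subtype.val : G₀ → Equiv.Perm (Fin d')) Subtype.val_injective
    have h3 : Nat.card (Equiv.Perm (Fin d')) = d'.factorial := by
      rw [Nat.card_eq_fintype_card, Fintype.card_perm, Fintype.card_fin]
    have h4 : d'.factorial ≤ d.factorial := Nat.factorial_le hd'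
    rw [hcardHom] at h1
    exact_mod_cast h1.trans (h2.trans (h3.le.trans h4))
  have hN : (N : ℝ) * (1 / 2) ^ (ν + 1) < ε / #(smallSets (Fin m) l) := by
    rw [lt_div_iff₀ hV]
    calc (N : ℝ) * (1 / 2) ^ (ν + 1) * #(smallSets (Fin m) l)
        ≤ ((d.factorial : ℕ) : ℝ) * (1 / 2) ^ (ν + 1) * #(smallSets (Fin m) l) := by gcongr
      _ < ε := hfrag
  have h1 : ∀ j, 𝓛 j ⊆ smallSets (Fin m) l := by
    intro j Y hY
    obtain ⟨i, -, rfl⟩ := mem_image.1 hY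
    exact hX i
  have h2 : ∀ x, O x = false → ∃ j, ∀ Y ∈ 𝓛 j, ¬ CliquePresent Y x := by
    intro x hx
    obtain ⟨φ, hφ, hK⟩ := (hiff x).1 hx
    refine ⟨e ⟨φ, hφ⟩, fun Y hY => ?_⟩
    obtain ⟨i, hi, rfl⟩ := mem_image.1 hY
    rw [mem_filter, Equiv.symm_apply_apply] at hi
    exact hK i hi.2
  have h3 : ∀ j x, (∀ Y ∈ 𝓛 j, ¬ CliquePresent Y x) → O x = false := fun j x hall =>
    (hiff x).2 ⟨(e.symm j).1, (e.symm j).2, fun i hi =>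
      hall (X i) (mem_image_of_mem X (mem_filter.2 ⟨mem_univ i, hi⟩))⟩
  obtain ⟨𝒜, h𝒜, hP, hNg⟩ := sg_of_maxtermCover m l k N ν t q (ε / #(smallSets (Fin m) l)) O 𝓛 h1 h2 h3
    hq0 hq1 hql (div_pos hε hV) hN htl
  refine ⟨𝒜, h𝒜, ?_, hNg.trans_eq (mul_div_cancel₀ ε hV.ne')⟩
  calc (#(lostPos m k O 𝒜) : ℝ) ≤ (((ν * l.choose 2) ^ t * (m - t).choose (k - t) : ℕ) : ℝ) := by
        exact_mod_cast hP
    _ ≤ ε * (m.choose k : ℝ) := hpos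

open DenseRegime in
/-- **SG_PERM for commutative PERM gates on `d` points with `log₂ (d!) ≤ m^{3/4}/2` (support lemma for
`stub_sgPerm`, stmt-PneNP-10681; a sub-range of the stub).** For every `c`, eventually in `m`, for every `d` with
`log₂ (d!) ≤ m^{3/4}/2` — in particular for all `d ≤ m^{3/4 - o(1)}` —
`SGAt m (commutative PERM_d gates) (lOf m) (kOf m) (qOf m) (epsOf c m)`: every PERM term gate whose generators
pairwise commute is `epsOf c m`-approximated one-sidedly on (bare `kOf m`-cliques) × `G(m, qOf m)` by a small-clique
DNF over `≤ lOf m`-atoms. The generic range for `PERM_d` is `d ≤ m^{3/8-o(1)}`. [folklore] -/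
theorem sgAt_commPerm_of_fewPoints :
    ∀ c : ℕ, ∀ᶠ m : ℕ in atTop, ∀ d : ℕ, Real.logb 2 (d.factorial) ≤ (m : ℝ) ^ (3 / 4 : ℝ) / 2 →
      SGAt m (fun g => ∃ d', d' ≤ d ∧ ∃ (σ : Fin g.1 → Equiv.Perm (Fin d')) (τ : Equiv.Perm (Fin d')),
          (∀ i j, σ i * σ j = σ j * σ i) ∧ ∀ v, g.2 v = true ↔ τ ∈ Subgroup.closure (σ '' {i | v i = true}))
        (lOf m) (kOf m) (qOf m) (epsOf c m) := by
  intro c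
  filter_upwards [stub_denseRegime c, permSmallDim_budgets c, eventually_ge_atTop 1] with m hD hB hm d hd
  obtain ⟨-, -, -, hq0, hq1, -, -, -, -, hhalf⟩ := hD
  obtain ⟨hpos, hfrag⟩ := hB
  have hmpos : (0 : ℝ) < m := by exact_mod_cast hm
  have hε : 0 < epsOf c m := by
    rw [epsOf_eq]
    positivity
  have hfpos : (0 : ℝ) < (d.factorial : ℕ) := by exact_mod_cast d.factorial_pos
  have hcard : ((d.factorial : ℕ) : ℝ) ≤ (2 : ℝ) ^ ((m : ℝ) ^ (3 / 4 : ℝ) / 2) :=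
    (Real.logb_le_iff_le_rpow one_lt_two hfpos).1 hd
  refine sgAt_commPerm_of_cover_budget m (lOf m) (kOf m) d ⌈(m : ℝ) ^ (3 / 4 : ℝ)⌉₊ (lOf m / 2)
    (qOf m) (epsOf c m) hq0 hq1 (by linarith) hε (Nat.mul_div_le (lOf m) 2) hpos ?_
  calc ((d.factorial : ℕ) : ℝ) * (1 / 2) ^ (⌈(m : ℝ) ^ (3 / 4 : ℝ)⌉₊ + 1) * #(smallSets (Fin m) (lOf m))
      ≤ (2 : ℝ) ^ ((m : ℝ) ^ (3 / 4 : ℝ) / 2) * (1 / 2) ^ (⌈(m : ℝ) ^ (3 / 4 : ℝ)⌉₊ + 1) *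
        #(smallSets (Fin m) (lOf m)) := by gcongr
    _ < epsOf c m := hfrag

end Summit.PneNP.PneNP.Theorems
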